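import Summits.Schanuel.Schanuel.Theorems.RootDecomp1KHyper41
import Summits.Schanuel.Schanuel.Theorems.RootDecomp1KHyper42

/-!
# RootDecomp1KHyper — lens 6, generation 16/17 «ALGEBRAIC-LATTICE-ANCHORED CELL» (AlgLatAnchor.lean edition 2 42f80a0c…, 1588 l) — part 1 (RootDecomp1KHyper47): §B Leibniz bound `mvlen_det_le`, `totalDegree_det_le`, `sylvester_entry_le`, `resultant_bounds`; §C `aeval_eq_zero_of_conj`; §D analytic helpers

PORT NOTE (census-1 gen 15, 2026-08-31): port of HOME/decomp-schanuel-lens-6/g17/AlgLatAnchor.lean EDITION 2 (sha256 42f80a0c…8416, 1588 l = the cap-reshaped re-issue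
of the graded g16 kernel bb3c3a11…, statements byte-identical — critic VERDICT STATUS L1677 (SECOND‴ MET, ONE cell-decision credit to lens-6 g16, RULE K-R20),
reshape rule L1684, verification L1713; CENSUS-REQUESTs L1676 / L1712, PORT GO LOW) in SIX parts `RootDecomp1KHyper47`–`52`: 47 = §B determinants / Sylvester resultant
bounds + §C conjugation + §D analytic helpers, 48 = §E0 the named engine pieces (`engQ`, `engCC`, `qev`, the resultant norm), 49 = §E THE RESULTANT ENGINE
`no_int_relation_of_mvWeakMeasure_hyperAlgLat` (312 l, `maxHeartbeats 4000000` as in the source) + `algebraicIndependent_option_of_mvWeakMeasure_hyperAlgLat`, 50 = §F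
independence / descent / lattice bounds / `HasAlgLatAnchor` / THE CELL `sb_three_of_algLatAnchor` / the carve `rank3SpanResidual_iff_unanchored₄`, 51 = §G the Gaussian member
`zG` + §H `not_hasMeasuredRatAnchor_zG`, 52 = §I the cyclotomic member `z8` + §J summary. §A (the `mvlen` length algebra) DROPPED in favour of the tree's
`RootDecomp1KHyper42` §A (imported; outer namespace); 21 one-line docstrings added; eleven generic one-liners (`intCast_eq_C'`, the §D copies of Hyper28's private
helpers, `norm_multiset_prod_map_le`, `isAlgebraic_sqrt_natCast_C'`, `isIntegral_I`, `isAlgebraic_I'`, `linearIndependent_one_of_im_ne_zero`, `linearIndependent_single_of_ne_zero`)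
made `private` with per-part private copies (gate dedup lint); statements and proofs verbatim; `hLW` / `h52` stay binders BY NAME. `--supports stmt-Schanuel-33363`;
no census credit. Nothing here proves Schanuel; rung 0. The lens's header follows.
-/

/-!
# AlgLatAnchor — lens 6, gen 16: the ALGEBRAIC-LATTICE-ANCHORED cell of the level-3 span residual
(EDITION 2, gen 17 — CAP RESHAPING ONLY, census L1683 / critic ACK L1684(b): the engine's steps (3)–(6) are lifted into
the named defs `qev`/`engCC`/`engQ` and the lemmas `engQ_natDegree_le`, `engCC_abs_le`, `engQ_coeff_bound`, `engQ_eval`,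
`aeval_resultant_engQ`, `qev_eq_zero_of_resultant_eq_zero` of §E0, each ≤ 150 lines; EVERY graded statement is byte-identical.)
(SECOND‴, critic VERDICT L1634 (d): a decided genuinely-ternary cell at RELATIVE DEGREE ≥ 2 with certified
members outside every excluded cell of `UnanchoredResidual₃‴` and outside the measured-rational-anchor cell)

Residual attacked: the level-3 span residual of `RootDecomp1K.HyperLiouvilleSchanuel` (stmt-Schanuel-33363),
`Rank3SpanResidual : ∀ z : Fin 3 → ℂ, ℚ-free → HyperLinLiouville z → ¬HasHLPairInSpan z → SB 3 z`, in its form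
of record `UnanchoredResidual₃‴` (tree `rank3SpanResidual_iff_unanchored₃''`: `… → ¬HasRealQuadAnchor z →
¬HasExpLatAnchor z → ¬HasPiLatAnchor z → SB 3 z`).

## The cell and the theorem

* `HasAlgLatAnchor z` : `span_ℤ(z)` contains two ℚ-linearly independent ALGEBRAIC numbers `w₁, w₂` — i.e. the
  lattice of `z` contains a rank-2 sublattice of a number field; equivalently (`ω = w₂/w₁ ∈ ℚ̄ ∖ ℚ`) an
  algebraic irrationality of ANY degree `d ≥ 2`, real or not.  The tree's `HasRealQuadAnchor` (`q₁, q₂√D`) is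
  the sub-case `d = 2`, `ω` real; NEW are the imaginary-quadratic lattices (`ℤ[i]`, `ℤ[ζ₃]`, …) and every
  degree `d ≥ 3` (`ℤ[∛2]`-type, cyclotomic `ℤ[ζ₈]`, …) — «relative degree ≥ 2» over any measured `θ`
  (PLAN-next-KR18-RLI §2: ℚ(θ) is purely transcendental, so an algebraic irrational anchor is NEVER
  ℚ(θ)-rational: the cell is disjoint from the measured-rational-anchor cell at the level of the anchors).

**`sb_three_of_algLatAnchor (hLW : LWMeasure)`: a ℚ-free `HyperLinLiouville` triple with an algebraic-lattice
anchor has Schanuel's bound `trdeg ℚ(z, e^z) ≥ 3`.**  Carve (mod LW, Cor. 5.2):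
`rank3SpanResidual_iff_unanchored₄ : Rank3SpanResidual ↔ ∀ z, ℚ-free → HLL → ¬HasHLPairInSpan →
¬HasExpLatAnchor → ¬HasPiLatAnchor → ¬HasAlgLatAnchor → SB 3 z` (the Q-cell is absorbed: `HasRealQuadAnchor →
HasAlgLatAnchor`).

## The lever (new): the RESULTANT ENGINE — a relative Liouville inequality by norm to `ℤ[x⃗]`

`no_int_relation_of_mvWeakMeasure_hyperAlgLat`: let `θ` be ANY tuple with an `MvWeakMeasure`, `ω` an
ALGEBRAIC INTEGER (`IsIntegral ℤ ω`; `f := minpoly ℤ ω`, monic irreducible of degree `d`), and `y`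
hyper-approximable from the algebraic lattice `ℤ + ℤω` (`HyperLatApprox 1 ω y`, approximants `x = (A + Bω)/E`).  Then NO relation `Σ_k G_k(θ) y^k = 0`,
`G_k ∈ ℤ[x⃗]` not all zero.  The tree's engine (`…_hyperLat`, W's IN `ℤ[θ]`) specialises the relation at `x`
and reads ONE integer polynomial in `θ`; here `x ∉ ℚ(θ)` and the specialisation `Q(θ, ω)`,
`Q(x⃗, T) = Σ_k G_k(x⃗)(A + BT)^k E^{K−k} ∈ ℤ[x⃗][T]`, is algebraic of degree `d` over `ℤ[θ]`.  The new move is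
the NORM TO `ℤ[x⃗]`: `N := Res_T(f, Q) ∈ ℤ[x⃗]` (Mathlib `Polynomial.resultant` over the ring `ℤ[x⃗]`), with
(i) `N(θ') = ∏_{f(r)=0} Q(θ', r)` for EVERY `θ' ∈ ℂⁿ` (`resultant_map_map` + `resultant_eq_prod_eval`);
(ii) `N ≠ 0`: otherwise, by (i) at all `θ'` and `MvPolynomial.funext`, some factor `Q(·, r) ≡ 0` in `ℂ[x⃗]`,
so every coefficient polynomial `g_e ∈ ℤ[T]` of `Q` vanishes at the conjugate `r`, hence (Gauss lemma +
`minpoly.dvd`) at `ω`: `Q(θ, ω) = E^K μ(x) = 0` — against the isolation of the root `y` of `μ = Σ G_k(θ)Y^k`;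
(iii) degree `≤ (d+K)·deg G` and length `≤ (d+K)!·(H(f) + (K+1)ΛX^{4K})^{d+K}` (Leibniz expansion of the
Sylvester determinant + the sub-multiplicativity of `mvlen`), POLYNOMIAL in the height `X = 1+E+|A|+|B|`;
(iv) `|N(θ)| = |Q(θ,ω)|·∏_{r≠ω}|Q(θ,r)| ≤ E^K·L·e^{−X^m}·(c X^K)^{d}` — hyper-small.  (iii)+(iv) contradict the
weak measure.  So `(y, θ)` is algebraically independent — for EVERY weakly measured `θ`: the anchor lattice
and the measured tuple are DECOUPLED (the lattice is algebraic, `θ` arbitrary), which is what makes the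
member certificates below (`¬HasExpLatAnchor`, `¬HasMeasuredRatAnchor`) one-liners of the same engine.

## Members (certified) and placement

* `z_G = (1, i, y_C(i))` — the GAUSSIAN member (`span_ℤ = ℤ[i] ⊕ ℤ y`), and `z_8 = (1, ζ₈, y_C(ζ₈))`,
  `ζ₈ = e^{iπ/4}` (degree 4): ℚ-free, `HyperLinLiouville`, `¬HasHLPairInSpan` UNCONDITIONALLY (tree §5e for
  any `Im ξ ≠ 0`); `¬HasRealQuadAnchor`, `¬HasPiLatAnchor` unconditionally; `¬HasExpLatAnchor` mod LW;
  `¬HasMeasuredRatAnchor` (the data of the tree's `sb_three_of_measuredRatAnchor`, as a predicate)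
  UNCONDITIONALLY — by the engine; `SB 3` mod LW.  So the new cell meets the residual of record in points
  outside all four excluded cells AND outside the measured-rational-anchor cell.

## Map

§A `mvlen` length algebra (twins of g15 `MeasuredAnchors` §A = census parts Hyper42, re-namespaced under
`LatCell` so either port order type-checks) · §B Leibniz bound for determinants over `ℤ[x⃗]` and the Sylvester
/ resultant length–degree bounds (`resultant_bounds`) · §C conjugation (`aeval_eq_zero_of_conj`, Gauss lemma) ·
§D analytic helpers · §E THE ENGINE `no_int_relation_of_mvWeakMeasure_hyperAlgLat` · §F independence
`algebraicIndependent_option_of_mvWeakMeasure_hyperAlgLat`, descent by an algebraic constant, the lattice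
bounds `weakLatLB_one_of_im_ne_zero` / `latLB_one_ofReal_of_irrational_root` (Liouville, Mathlib), the cell
`HasAlgLatAnchor`, `HasRealQuadAnchor.hasAlgLatAnchor`, THE CELL THEOREM `sb_three_of_algLatAnchor`, THE CARVE
`rank3SpanResidual_iff_unanchored₄` · §G the Gaussian member `zG` and its placement · §H `HasMeasuredRatAnchor`
(faithful: `sb_three_of_hasMeasuredRatAnchor`) and `not_hasMeasuredRatAnchor_zG` (unconditional) · §I the
degree-4 member `z8` · §J the residual of record and the LIVE item evaluated at the members.

PATH T kernel file (HOME g16), no tree write; 0 sorry; axioms standard (Probe); planted controls (Ctrl).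
-/

open Complex IntermediateField Polynomial

namespace Summit.Schanuel.Schanuel.Theorems.RootDecomp1KHyper

namespace HyperCell

namespace LatCell

variable {n : ℕ}
open Summit.Schanuel.Schanuel.Theorems.RootDecomp1KGeneric (HasHLPairInSpan Rank3SpanResidual
  mem_adjoin_of_mem_span cexp_mem_adjoin_of_mem_span)

/-! ## §A  Length algebra of `mvlen` — PORT: the tree's `RootDecomp1KHyper42` §A (outer namespace `…RootDecomp1KHyper`, imported above) is used;
the source's re-namespaced copies are dropped. -/

/-- An integer cast into `ℤ[x⃗]` is the constant `C`. -/
private theorem intCast_eq_C' (k : ℤ) : ((k : ℤ) : MvPolynomial (Fin n) ℤ) = MvPolynomial.C k := by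
  rw [← map_intCast (MvPolynomial.C : ℤ →+* MvPolynomial (Fin n) ℤ) k, Int.cast_id]

/-! ## §B  Determinants over `ℤ[x⃗]`: length and degree of a Sylvester resultant -/

/-- **Leibniz bound**: an `N × N` determinant with entries of length `≤ B` has length `≤ N!·B^N`. -/
theorem mvlen_det_le {N : ℕ} (M : Matrix (Fin N) (Fin N) (MvPolynomial (Fin n) ℤ)) {B : ℤ}
    (hM : ∀ i j, mvlen (M i j) ≤ B) : mvlen M.det ≤ (Nat.factorial N : ℤ) * B ^ N := by
  rw [Matrix.det_apply']
  refine (mvlen_sum_le _ _).trans ?_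
  have hσ : ∀ σ : Equiv.Perm (Fin N),
      mvlen (((Equiv.Perm.sign σ : ℤ) : MvPolynomial (Fin n) ℤ) * ∏ i, M (σ i) i) ≤ B ^ N := by
    intro σ
    rw [intCast_eq_C']
    have habs : |((Equiv.Perm.sign σ : ℤˣ) : ℤ)| = 1 := Int.isUnit_iff_abs_eq.mp (Units.isUnit _)
    calc mvlen (MvPolynomial.C ((Equiv.Perm.sign σ : ℤˣ) : ℤ) * ∏ i, M (σ i) i)
        ≤ |((Equiv.Perm.sign σ : ℤˣ) : ℤ)| * mvlen (∏ i, M (σ i) i) := mvlen_C_mul_le _ _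
      _ = mvlen (∏ i, M (σ i) i) := by rw [habs, one_mul]
      _ ≤ ∏ i, mvlen (M (σ i) i) := mvlen_prod_le _ _
      _ ≤ ∏ _i : Fin N, B := Finset.prod_le_prod (fun i _ => mvlen_nonneg _) fun i _ => hM _ _
      _ = B ^ N := by rw [Finset.prod_const, Finset.card_univ, Fintype.card_fin]
  calc ∑ σ : Equiv.Perm (Fin N), mvlen (((Equiv.Perm.sign σ : ℤ) : MvPolynomial (Fin n) ℤ) *
          ∏ i, M (σ i) i)
      ≤ ∑ _σ : Equiv.Perm (Fin N), B ^ N := Finset.sum_le_sum fun σ _ => hσ σ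
    _ = (Nat.factorial N : ℤ) * B ^ N := by
        rw [Finset.sum_const, Finset.card_univ, Fintype.card_perm, Fintype.card_fin, nsmul_eq_mul]

/-- Degree of a determinant with entries of total degree `≤ D`: `≤ N·D`. -/
theorem totalDegree_det_le {N : ℕ} (M : Matrix (Fin N) (Fin N) (MvPolynomial (Fin n) ℤ)) {D : ℕ}
    (hM : ∀ i j, (M i j).totalDegree ≤ D) : M.det.totalDegree ≤ N * D := by
  rw [Matrix.det_apply']
  refine MvPolynomial.totalDegree_finsetSum_le fun σ _ => ?_
  rw [intCast_eq_C']
  calc (MvPolynomial.C ((Equiv.Perm.sign σ : ℤˣ) : ℤ) * ∏ i, M (σ i) i).totalDegree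
      ≤ (MvPolynomial.C ((Equiv.Perm.sign σ : ℤˣ) : ℤ) : MvPolynomial (Fin n) ℤ).totalDegree +
          (∏ i, M (σ i) i).totalDegree := MvPolynomial.totalDegree_mul _ _
    _ = (∏ i, M (σ i) i).totalDegree := by rw [MvPolynomial.totalDegree_C, zero_add]
    _ ≤ ∑ i, (M (σ i) i).totalDegree := MvPolynomial.totalDegree_finsetProd _ _
    _ ≤ ∑ _i : Fin N, D := Finset.sum_le_sum fun i _ => hM _ _
    _ = N * D := by rw [Finset.sum_const, Finset.card_univ, Fintype.card_fin, smul_eq_mul]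

/-- Entries of a Sylvester matrix over `ℤ[x⃗]` inherit the length/degree bounds of the coefficients. -/
theorem sylvester_entry_le (f g : Polynomial (MvPolynomial (Fin n) ℤ)) (m k : ℕ) {B : ℤ} {D : ℕ}
    (hB : 0 ≤ B) (hf : ∀ t, mvlen (f.coeff t) ≤ B ∧ (f.coeff t).totalDegree ≤ D)
    (hg : ∀ t, mvlen (g.coeff t) ≤ B ∧ (g.coeff t).totalDegree ≤ D) (i j : Fin (m + k)) :
    mvlen (Polynomial.sylvester f g m k i j) ≤ B ∧
      (Polynomial.sylvester f g m k i j).totalDegree ≤ D := by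
  unfold Polynomial.sylvester
  rw [Matrix.of_apply]
  induction j using Fin.addCases with
  | left j₁ =>
    rw [Fin.addCases_left]
    split_ifs
    · exact hg _
    · exact ⟨by rw [mvlen_zero]; exact hB, by rw [MvPolynomial.totalDegree_zero]; exact Nat.zero_le _⟩
  | right j₁ =>
    rw [Fin.addCases_right]
    split_ifs
    · exact hf _
    · exact ⟨by rw [mvlen_zero]; exact hB, by rw [MvPolynomial.totalDegree_zero]; exact Nat.zero_le _⟩

/-- **Length and degree of a resultant over `ℤ[x⃗]`.** -/
theorem resultant_bounds (f g : Polynomial (MvPolynomial (Fin n) ℤ)) (m k : ℕ) {B : ℤ} {D : ℕ}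
    (hB : 0 ≤ B) (hf : ∀ t, mvlen (f.coeff t) ≤ B ∧ (f.coeff t).totalDegree ≤ D)
    (hg : ∀ t, mvlen (g.coeff t) ≤ B ∧ (g.coeff t).totalDegree ≤ D) :
    mvlen (Polynomial.resultant f g m k) ≤ (Nat.factorial (m + k) : ℤ) * B ^ (m + k) ∧
      (Polynomial.resultant f g m k).totalDegree ≤ (m + k) * D := by
  unfold Polynomial.resultant
  exact ⟨mvlen_det_le _ fun i j => (sylvester_entry_le f g m k hB hf hg i j).1,
    totalDegree_det_le _ fun i j => (sylvester_entry_le f g m k hB hf hg i j).2⟩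

/-! ## §C  Conjugation: an integer polynomial vanishing at one root of an irreducible `f ∈ ℤ[T]`
vanishes at every root (Gauss lemma + `minpoly.dvd`) -/

/-- If `f ∈ ℤ[T]` is monic irreducible with complex roots `r, ω` and `g ∈ ℤ[T]` vanishes at `r`, then
`g(ω) = 0`. -/
theorem aeval_eq_zero_of_conj {f : ℤ[X]} (hfm : f.Monic) (hfi : Irreducible f) {r ω : ℂ}
    (hr : Polynomial.aeval r f = 0) (hω : Polynomial.aeval ω f = 0) {g : ℤ[X]}
    (hg : Polynomial.aeval r g = 0) : Polynomial.aeval ω g = 0 := by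
  set fQ : ℚ[X] := f.map (algebraMap ℤ ℚ) with hfQ
  have hirrQ : Irreducible fQ := (hfm.irreducible_iff_irreducible_map_fraction_map (K := ℚ)).mp hfi
  have hmonQ : fQ.Monic := hfm.map _
  have hrQ : Polynomial.aeval r fQ = 0 := by rw [hfQ, Polynomial.aeval_map_algebraMap]; exact hr
  have hωQ : Polynomial.aeval ω fQ = 0 := by rw [hfQ, Polynomial.aeval_map_algebraMap]; exact hω
  have h1 : fQ = minpoly ℚ r := minpoly.eq_of_irreducible_of_monic hirrQ hrQ hmonQ
  have h2 : fQ = minpoly ℚ ω := minpoly.eq_of_irreducible_of_monic hirrQ hωQ hmonQ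
  have hgQ : Polynomial.aeval r (g.map (algebraMap ℤ ℚ)) = 0 := by
    rw [Polynomial.aeval_map_algebraMap]; exact hg
  have hdvd : minpoly ℚ r ∣ g.map (algebraMap ℤ ℚ) := minpoly.dvd ℚ r hgQ
  rw [← h1, h2] at hdvd
  have h3 := Polynomial.aeval_eq_zero_of_dvd_aeval_eq_zero hdvd (minpoly.aeval ℚ ω)
  rwa [Polynomial.aeval_map_algebraMap] at h3

/-! ## §D  Analytic helpers (copies of the tree's private one-liners of `RootDecomp1KHyper28`) -/

/-- `exp(−x) ≤ 1/x` for `x > 0`. -/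
private theorem exp_neg_le_one_div₄ {x : ℝ} (hx : 0 < x) : Real.exp (-x) ≤ 1 / x := by
  rw [Real.exp_neg, ← one_div]
  exact one_div_le_one_div_of_le hx (by linarith [Real.add_one_le_exp x])

/-- Near a complex point `y`, a nonzero complex polynomial has no root other than (possibly) `y`. -/
private theorem exists_ball_eval_ne_zeroC₄ (μ : ℂ[X]) (hμ : μ ≠ 0) (y : ℂ) :
    ∃ δ : ℝ, 0 < δ ∧ ∀ w : ℂ, w ≠ y → ‖w - y‖ < δ → μ.eval w ≠ 0 := by
  have hfin : {x : ℂ | μ.IsRoot x}.Finite := Polynomial.finite_setOf_isRoot hμ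
  set T : Set ℂ := {x : ℂ | μ.IsRoot x} \ {y} with hT
  have hTfin : T.Finite := hfin.sdiff
  have hopen : Tᶜ ∈ nhds y := hTfin.isClosed.isOpen_compl.mem_nhds fun h => h.2 rfl
  obtain ⟨δ, hδ, hball⟩ := Metric.mem_nhds_iff.mp hopen
  refine ⟨δ, hδ, fun w hw hwδ hroot => ?_⟩
  have hwT : w ∈ T := ⟨hroot, hw⟩
  have hwb : w ∈ Metric.ball y δ := by rw [Metric.mem_ball, dist_eq_norm]; exact hwδ
  exact hball hwb hwT

/-- Lipschitz bound at a complex root: `‖μ(w)‖ ≤ M ‖w − y‖` for `‖w − y‖ ≤ 1`. -/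
private theorem exists_lipschitz_at_rootC₄ (μ : ℂ[X]) (y : ℂ) (hroot : μ.eval y = 0) :
    ∃ M : ℝ, 0 < M ∧ ∀ w : ℂ, ‖w - y‖ ≤ 1 → ‖μ.eval w‖ ≤ M * ‖w - y‖ := by
  set ν := μ /ₘ (X - C y) with hν
  have hdvd : (X - C y) * ν = μ := Polynomial.mul_divByMonic_eq_iff_isRoot.mpr hroot
  obtain ⟨M₀, hM₀⟩ := (isCompact_closedBall y 1).exists_bound_of_continuousOn
    (Polynomial.continuous ν).continuousOn
  refine ⟨max M₀ 0 + 1, by positivity, fun w hw => ?_⟩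
  have hmem : w ∈ Metric.closedBall y 1 := by rw [Metric.mem_closedBall, dist_eq_norm]; exact hw
  have h1 : μ.eval w = (w - y) * ν.eval w := by
    conv_lhs => rw [← hdvd]
    rw [eval_mul, eval_sub, eval_X, eval_C]
  rw [h1, norm_mul]
  calc ‖w - y‖ * ‖ν.eval w‖ ≤ ‖w - y‖ * M₀ := by gcongr; exact hM₀ _ hmem
    _ ≤ ‖w - y‖ * (max M₀ 0 + 1) := by gcongr; linarith [le_max_left M₀ 0]
    _ = (max M₀ 0 + 1) * ‖w - y‖ := mul_comm _ _

/-- The binomial sum over `Fin (K+1)` with the vanishing binomial coefficients beyond `k`. -/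
private theorem sum_fin_choose_eq_add_pow₄ {R : Type*} [CommRing R] {K : ℕ} (k : Fin (K + 1)) (u v : R) :
    ∑ i : Fin (K + 1), ((Nat.choose k i : ℕ) : R) * u ^ (i : ℕ) * v ^ ((k : ℕ) - i) =
      (u + v) ^ (k : ℕ) := by
  have hk : (k : ℕ) + 1 ≤ K + 1 := Nat.succ_le_succ (Nat.lt_succ_iff.mp k.2)
  rw [Fin.sum_univ_eq_sum_range (fun i => ((Nat.choose k i : ℕ) : R) * u ^ i * v ^ ((k : ℕ) - i))
    (K + 1), add_pow]
  symm
  rw [← Finset.sum_subset (Finset.range_subset_range.mpr hk)]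
  · exact Finset.sum_congr rfl fun i _ => by ring
  · intro i _ hi
    have hlt : (k : ℕ) < i := by
      rw [Finset.mem_range] at hi; omega
    rw [Nat.choose_eq_zero_of_lt hlt]; simp

/-- Norm of a product over a multiset with factors of norm `≤ b`. -/
private theorem norm_multiset_prod_map_le (s : Multiset ℂ) (g : ℂ → ℂ) {b : ℝ} (hb : 0 ≤ b)
    (h : ∀ r ∈ s, ‖g r‖ ≤ b) : ‖(s.map g).prod‖ ≤ b ^ Multiset.card s := by
  induction s using Multiset.induction_on with
  | empty => simp
  | cons a s ih =>
    rw [Multiset.map_cons, Multiset.prod_cons, Multiset.card_cons, pow_succ, norm_mul, mul_comm]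
    exact mul_le_mul (ih fun r hr => h r (Multiset.mem_cons_of_mem hr)) (h a (Multiset.mem_cons_self a s))
      (norm_nonneg _) (pow_nonneg hb _)

end LatCell

end HyperCell

end Summit.Schanuel.Schanuel.Theorems.RootDecomp1KHyper
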